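import Summits.QuantumFields.YangMills.Theorems.SwapVirialDeficitSectorLaplaceBulkStub
import Summits.QuantumFields.YangMills.Theorems.SwapVirialDeficitSectorLaplaceMbDensityPointwise
import Summits.QuantumFields.YangMills.Theorems.SwapVirialDeficitBlowUpVirialChart
import Summits.QuantumFields.YangMills.Theorems.SwapVirialDeficitBlowUpVirialRing
import HarnessLib

/-!
# (S)-road, stub S2i: THE BULK FIBRED LAW INTEGRATED OVER THE BULK HUBS (sector 000), in the letters of ✓`SectorLaplaceDefs`
# (free-hands support of ⟨stmt-QuantumFields-24197⟩ `SwapVirialDeficit.SwapGluedStiffness` ∕ ⟨24194⟩ `SwapMeanActionGap`; cell ym-idea-1, assembler fcl-p3 g47)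

Stub S2 (w2 g59 ✓`SectorLaplace.bulk_fibred`) is POINTWISE in the hub: for `a ∈ HubBulk ψ₀` and good signs `ε`,
`|boxIntegral a ε b V₀ − (2π∕b)^α·m_ε(a)| ≤ r·(2π∕b)^α·m_ε(a) + (∫ρ)·E`, `m_ε(a) = ∫_{BaseBox V₀} 𝔪(a,ε,·)`, `r = K L^k (V₀∕ψ₀)^k b^{−1∕2}`,
`E = e^{−b(ψ₀∕(K L^k V₀^k))^k}`.  The assembly (✓`window_arith`, input S2i) wants it INTEGRATED: `bulkIntegral = K_L·Σ_{good ε}∫_{HubBulk} boxIntegral ∂cone` against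
`mbBulk = K_L·Σ_{good ε}∫_{HubBulk} m_ε ∂cone`.  This file does that bookkeeping:

* §1 measurability of the letters (`measurable_hubS1`, `measurable_hubS2`, `measurableSet_hubBulk`, `measurableSet_gnoBox`, `measurableSet_baseBox`);
* §2 the box integral as a function of the hub: `0 ≤ boxIntegral ≤ ∫ρ` (`b ≥ 0`), ★ `stronglyMeasurable_boxIntegral` (joint measurability ✓`measurable_gnoDeficit_uncurry` +
  `StronglyMeasurable.integral_prod_right'`), `integrable_boxIntegral` (cone is a probability law);
* §3 the boxed Morse–Bott mass `a ↦ ∫_{BaseBox} 𝔪` is cone-integrable GIVEN S3's joint integrability (`Integrable.integral_prod_left`), `mbBulk_nonneg`;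
* §4 the generic two-sided integration `setIntegral_two_sided_of_pointwise` (`|∫_S I − A∫_S m| ≤ r·A∫_S m + X·μ(S)`);
* §5 ★★ `bulk_integrated_of_pointwise` = the skeleton's `stub_bulk_integrated_of_pointwise` VERBATIM (S2 + S3 ⟹ S2i; `K_L·#signs·∫ρ = 1` ✓`gnomonic_total_mass_real`
  eats the absolute term), ★ `bulk_integrated_of_S3` (S2 := ✓`bulk_fibred`).

HONEST LABEL: measure-theoretic glue; conditional on stub S3 (hypothesis); ⟨24197⟩ ∕ ⟨24194⟩ OPEN; ⟨24196⟩ proved elsewhere; item of record ⟨24085⟩ SubOctaveBounded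
aside ∕ untouched; the Yang–Mills mass gap is NOT proved; no summit is proved by a line.  THEOREMS ONLY (0 `def`, 0 `sorry`), standard axioms; the
`attribute [local instance]` block is the chart's measurable structure on `ℍ` (as in ✓`SectorLaplaceDefs`; nothing overridden).  Seat ym-line-fcl-p3 g47
(cell ym-idea-1, free hands), `--supports stmt-QuantumFields-24197`.  References: [cite: Luscher1983, §2]; [folklore].
-/

set_option autoImplicit false
set_option synthInstance.maxSize 1024

noncomputable section

open MeasureTheory Quaternion Set
open scoped Quaternion BigOperators ENNReal
open Literature.MathematicalPhysics.QuantumLattice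
open Literature.MathematicalPhysics.QuantumFieldTheory hiding SU2
open Summit.QuantumFields.YangMills.Theorems.SwapTwistDeficit.ToronLog

attribute [local instance] Literature.Analysis.FluidPDE.Tao2016.quatMeasurableSpace
  Literature.Analysis.FluidPDE.Tao2016.quatBorelSpace
  Literature.MathematicalPhysics.QuantumLattice.secondCountableTopology_su2

namespace Summit.QuantumFields.YangMills.Theorems.SwapVirialDeficit.SectorLaplace

open Summit.QuantumFields.YangMills.Theorems.FemtoTransferGap
open Summit.QuantumFields.YangMills.Theorems.FemtoTransferGap.TT
open Summit.QuantumFields.YangMills.Theorems.VirialFluxGap.RingDeficit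
open Summit.QuantumFields.YangMills.Theorems.SwapVirialDeficit.SwapRing
open Summit.QuantumFields.YangMills.Theorems.SwapVirialDeficit.BlowUpRing

/-! ## §1 Measurability of the letters -/

/-- `hubS1 = sin²2ψ` is measurable in the hub. [folklore] -/
theorem measurable_hubS1 : Measurable hubS1 := by
  have hn : Measurable fun a : ℍ => ‖a‖⁻¹ := measurable_norm.inv
  have hre : Measurable fun a : ℍ => a.re := Quaternion.continuous_re.measurable
  have him : Measurable fun a : ℍ => ‖a.im‖ := Quaternion.continuous_im.measurable.norm
  have h : Measurable fun a : ℍ => (2 * (‖a‖⁻¹ * a.re) * (‖a‖⁻¹ * ‖a.im‖)) ^ 2 :=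
    ((measurable_const.mul (hn.mul hre)).mul (hn.mul him)).pow_const 2
  exact h

/-- `hubS2 = sin²ψ` is measurable in the hub. [folklore] -/
theorem measurable_hubS2 : Measurable hubS2 := by
  have hn : Measurable fun a : ℍ => ‖a‖⁻¹ := measurable_norm.inv
  have him : Measurable fun a : ℍ => ‖a.im‖ := Quaternion.continuous_im.measurable.norm
  have h : Measurable fun a : ℍ => (‖a‖⁻¹ * ‖a.im‖) ^ 2 := (hn.mul him).pow_const 2
  exact h

/-- The bulk hubs form a measurable set. [folklore] -/
theorem measurableSet_hubBulk (ψ₀ : ℝ) : MeasurableSet (HubBulk ψ₀) := by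
  have e : HubBulk ψ₀ = {a : ℍ | a ≠ 0} ∩ ({a : ℍ | ψ₀ ≤ hubS1 a} ∩ {a : ℍ | ψ₀ ≤ hubS2 a}) := by
    ext a; simp only [HubBulk, Set.mem_setOf_eq, Set.mem_inter_iff]
  rw [e]
  exact (measurableSet_singleton (0 : ℍ)).compl.inter
    ((measurableSet_le measurable_const measurable_hubS1).inter (measurableSet_le measurable_const measurable_hubS2))

variable {L : ℕ} [NeZero L]

omit [NeZero L] in
/-- `GnoBox V₀` is measurable. [folklore] -/
theorem measurableSet_gnoBox (V₀ : ℝ) : MeasurableSet (GnoBox (L := L) V₀) := by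
  have h1 : Measurable fun η : GnoCoord L => η.1.1 0 := (measurable_pi_apply 0).comp (measurable_fst.comp measurable_fst)
  have h2 : Measurable fun η : GnoCoord L => η.1.2 0 := (measurable_pi_apply 0).comp (measurable_snd.comp measurable_fst)
  exact (measurableSet_le h1.abs measurable_const).inter (measurableSet_le h2.abs measurable_const)

/-- `BaseBox V₀` is measurable. [folklore] -/
theorem measurableSet_baseBox (V₀ : ℝ) : MeasurableSet (BaseBox V₀) :=
  (measurableSet_le measurable_fst.abs measurable_const).inter (measurableSet_le measurable_snd.abs measurable_const)

/-! ## §2 The box integral as a function of the hub -/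

/-- The fibre integrand `e^{−bF̂}ρ` is integrable (`b ≥ 0`: bounded by `ρ`). [folklore] -/
theorem integrable_fibreIntegrand {b : ℝ} (hb : 0 ≤ b) (a : ℍ) (ε : GnoSign L) :
    Integrable fun η : GnoCoord L => Real.exp (-(b * gnoDeficit z₀ (fun _ => 1) a ε η)) * gnoDensity η := by
  refine (integrable_gnoDensity (L := L)).mono'
    ((((measurable_gnoDeficit z₀ _ a ε).const_mul b).neg.exp.mul measurable_gnoDensity).aestronglyMeasurable)
    (Filter.Eventually.of_forall fun η => ?_)
  rw [Real.norm_eq_abs, abs_mul, abs_of_pos (Real.exp_pos _), abs_of_pos (gnoDensity_pos η)]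
  refine mul_le_of_le_one_left (gnoDensity_pos η).le (Real.exp_le_one_iff.2 ?_)
  have := gnoDeficit_nonneg z₀ (fun _ => (1 : SU2)) a ε η
  nlinarith

/-- The fibre integrand is non-negative. [folklore] -/
theorem fibreIntegrand_nonneg (b : ℝ) (a : ℍ) (ε : GnoSign L) (η : GnoCoord L) :
    0 ≤ Real.exp (-(b * gnoDeficit z₀ (fun _ => 1) a ε η)) * gnoDensity η :=
  mul_nonneg (Real.exp_pos _).le (gnoDensity_pos η).le

/-- `0 ≤ boxIntegral`. [folklore] -/
theorem boxIntegral_nonneg (a : ℍ) (ε : GnoSign L) (b V₀ : ℝ) : 0 ≤ boxIntegral a ε b V₀ := by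
  unfold boxIntegral
  exact integral_nonneg fun η => Set.indicator_nonneg (fun x _ => fibreIntegrand_nonneg b a ε x) η

/-- `boxIntegral ≤ ∫ e^{−bF̂}ρ ≤ ∫ρ` (`b ≥ 0`). [folklore] -/
theorem boxIntegral_le_mass {b : ℝ} (hb : 0 ≤ b) (a : ℍ) (ε : GnoSign L) (V₀ : ℝ) :
    boxIntegral a ε b V₀ ≤ ∫ η : GnoCoord L, gnoDensity η := by
  unfold boxIntegral
  calc ∫ η : GnoCoord L, (GnoBox V₀).indicator (fun η => Real.exp (-(b * gnoDeficit z₀ (fun _ => 1) a ε η)) * gnoDensity η) η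
      ≤ ∫ η : GnoCoord L, Real.exp (-(b * gnoDeficit z₀ (fun _ => 1) a ε η)) * gnoDensity η :=
        integral_mono ((integrable_fibreIntegrand hb a ε).indicator (measurableSet_gnoBox V₀)) (integrable_fibreIntegrand hb a ε)
          (fun η => Set.indicator_le_self' (fun x _ => fibreIntegrand_nonneg b a ε x) η)
    _ ≤ ∫ η : GnoCoord L, gnoDensity η := by
        refine integral_mono (integrable_fibreIntegrand hb a ε) integrable_gnoDensity fun η => ?_
        refine mul_le_of_le_one_left (gnoDensity_pos η).le (Real.exp_le_one_iff.2 ?_)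
        have := gnoDeficit_nonneg z₀ (fun _ => (1 : SU2)) a ε η
        nlinarith

/-- ★ `a ↦ boxIntegral a ε b V₀` is strongly measurable in the hub (✓`measurable_gnoDeficit_uncurry` + `StronglyMeasurable.integral_prod_right'`). [folklore] -/
theorem stronglyMeasurable_boxIntegral (ε : GnoSign L) (b V₀ : ℝ) : StronglyMeasurable fun a : ℍ => boxIntegral a ε b V₀ := by
  have hF : Measurable fun p : ℍ × GnoCoord L => Real.exp (-(b * gnoDeficit z₀ (fun _ => 1) p.1 ε p.2)) * gnoDensity p.2 :=
    (((measurable_gnoDeficit_uncurry z₀ (fun _ => 1) ε).const_mul b).neg.exp.mul (measurable_gnoDensity.comp measurable_snd))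
  have hI : Measurable fun p : ℍ × GnoCoord L => (Prod.snd ⁻¹' GnoBox (L := L) V₀).indicator
      (fun p : ℍ × GnoCoord L => Real.exp (-(b * gnoDeficit z₀ (fun _ => 1) p.1 ε p.2)) * gnoDensity p.2) p :=
    hF.indicator (measurable_snd (measurableSet_gnoBox V₀))
  have e : (fun a : ℍ => boxIntegral a ε b V₀) = fun a : ℍ => ∫ η : GnoCoord L, (Prod.snd ⁻¹' GnoBox (L := L) V₀).indicator
      (fun p : ℍ × GnoCoord L => Real.exp (-(b * gnoDeficit z₀ (fun _ => 1) p.1 ε p.2)) * gnoDensity p.2) (a, η) := by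
    funext a
    unfold boxIntegral
    refine integral_congr_ae (Filter.Eventually.of_forall fun η => ?_)
    rfl
  rw [e]
  exact hI.stronglyMeasurable.integral_prod_right'

/-- `a ↦ boxIntegral a ε b V₀` is integrable for the (probability) cone law (`b ≥ 0`). [folklore] -/
theorem integrable_boxIntegral {b : ℝ} (hb : 0 ≤ b) (ε : GnoSign L) (V₀ : ℝ) :
    Integrable (fun a : ℍ => boxIntegral a ε b V₀) coneMeasure := by
  haveI := isProbabilityMeasure_coneMeasure
  refine (integrable_const (∫ η : GnoCoord L, gnoDensity η)).mono' (stronglyMeasurable_boxIntegral ε b V₀).aestronglyMeasurable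
    (Filter.Eventually.of_forall fun a => ?_)
  rw [Real.norm_eq_abs, abs_of_nonneg (boxIntegral_nonneg a ε b V₀)]
  exact boxIntegral_le_mass hb a ε V₀

/-! ## §3 The boxed Morse–Bott mass as a function of the hub (given S3) -/

/-- ★ GIVEN S3's joint integrability of `𝔪_ε`, the boxed mass `a ↦ ∫_{BaseBox V₀} 𝔪(a,ε,·)` is cone-integrable (`Integrable.integral_prod_left`). [folklore] -/
theorem integrable_baseBoxMass {ε : GnoSign L}
    (hint : Integrable (fun ap : ℍ × (ℝ × ℝ) => mbDensity (L := L) ap.1 ε ap.2) (coneMeasure.prod volume)) (V₀ : ℝ) :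
    Integrable (fun a : ℍ => ∫ p in BaseBox V₀, mbDensity (L := L) a ε p) coneMeasure := by
  have h1 : Integrable (fun ap : ℍ × (ℝ × ℝ) => ((Set.univ : Set ℍ) ×ˢ BaseBox V₀).indicator
      (fun ap : ℍ × (ℝ × ℝ) => mbDensity (L := L) ap.1 ε ap.2) ap) (coneMeasure.prod volume) :=
    hint.indicator (MeasurableSet.univ.prod (measurableSet_baseBox V₀))
  have h2 := h1.integral_prod_left
  refine h2.congr (Filter.Eventually.of_forall fun a => ?_)
  show ∫ p : ℝ × ℝ, ((Set.univ : Set ℍ) ×ˢ BaseBox V₀).indicator (fun ap : ℍ × (ℝ × ℝ) => mbDensity (L := L) ap.1 ε ap.2) (a, p) =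
    ∫ p in BaseBox V₀, mbDensity (L := L) a ε p
  rw [← integral_indicator (measurableSet_baseBox V₀)]
  refine integral_congr_ae (Filter.Eventually.of_forall fun p => ?_)
  classical
  simp only [Set.indicator_apply, Set.mem_prod, Set.mem_univ, true_and]

/-- The boxed mass is non-negative. [folklore] -/
theorem baseBoxMass_nonneg (a : ℍ) (ε : GnoSign L) (V₀ : ℝ) : 0 ≤ ∫ p in BaseBox V₀, mbDensity (L := L) a ε p :=
  setIntegral_nonneg (measurableSet_baseBox V₀) fun p _ => mbDensity_nonneg a ε p

/-- `0 ≤ mbBulk`. [folklore] -/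
theorem mbBulk_nonneg (ψ₀ V₀ : ℝ) : 0 ≤ mbBulk L ψ₀ V₀ := by
  have hKL : 0 ≤ KL L := by have := coneConst_pos; unfold KL; positivity
  unfold mbBulk
  exact mul_nonneg hKL (Finset.sum_nonneg fun ε _ =>
    setIntegral_nonneg (measurableSet_hubBulk ψ₀) fun a _ => baseBoxMass_nonneg a ε V₀)

/-! ## §4 Generic: integrating a pointwise two-sided law -/

/-- ★ **INTEGRATING A POINTWISE TWO-SIDED LAW**: on a set `S` of finite measure, if `|I − A·m| ≤ r·(A·m) + X` pointwise on `S` with `I`, `m` integrable on `S`,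
then `|∫_S I − A·∫_S m| ≤ r·(A·∫_S m) + X·μ(S)` (`μ.real S`). [folklore] -/
theorem setIntegral_two_sided_of_pointwise {α : Type*} [MeasurableSpace α] {μ : Measure α} {S : Set α} (hS : MeasurableSet S)
    (hSfin : μ S ≠ ⊤) {I m : α → ℝ} {A r X : ℝ} (hI : IntegrableOn I S μ) (hm : IntegrableOn m S μ)
    (h : ∀ a ∈ S, |I a - A * m a| ≤ r * (A * m a) + X) :
    |∫ a in S, I a ∂μ - A * ∫ a in S, m a ∂μ| ≤ r * (A * ∫ a in S, m a ∂μ) + X * μ.real S := by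
  have hAm : IntegrableOn (fun a => A * m a) S μ := hm.const_mul A
  have hsub : IntegrableOn (fun a => I a - A * m a) S μ := hI.sub hAm
  have hX : IntegrableOn (fun _ : α => X) S μ := by rw [integrableOn_const_iff]; exact Or.inr hSfin.lt_top
  have hrhs : IntegrableOn (fun a => r * (A * m a) + X) S μ := (hAm.const_mul r).add hX
  have e1 : ∫ a in S, I a ∂μ - A * ∫ a in S, m a ∂μ = ∫ a in S, (I a - A * m a) ∂μ := by
    rw [integral_sub hI hAm, integral_const_mul]
  rw [e1]
  calc |∫ a in S, (I a - A * m a) ∂μ| ≤ ∫ a in S, |I a - A * m a| ∂μ := abs_integral_le_integral_abs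
    _ ≤ ∫ a in S, (r * (A * m a) + X) ∂μ :=
        integral_mono_ae hsub.abs hrhs (ae_restrict_of_forall_mem hS fun a ha => h a ha)
    _ = r * (A * ∫ a in S, m a ∂μ) + X * μ.real S := by
        rw [integral_add (hAm.const_mul r) hX, integral_const_mul, integral_const_mul, setIntegral_const, smul_eq_mul]
        ring

/-! ## §5 Stub S2i -/

set_option maxHeartbeats 400000 in
/-- ★★ **STUB S2i OF THE SKELETON (`stub_bulk_integrated_of_pointwise` VERBATIM): S2 + S3 ⟹ the integrated bulk law.**  Integrate S2's pointwise two-sided law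
over `HubBulk ψ₀` against the probability `coneMeasure` (§4), sum over the good sign patterns, and eat the absolute term with `K_L·#signs·∫ρ = 1`
(✓`gnomonic_total_mass_real`). [cite: Luscher1983, §2] -/
theorem bulk_integrated_of_pointwise
    (hS2 : ∃ K : ℝ, 0 < K ∧ ∃ k : ℕ, ∀ (L : ℕ) [NeZero L] (ψ₀ V₀ b : ℝ), 0 < ψ₀ → ψ₀ ≤ 1 → 1 ≤ V₀ →
      (K * (L : ℝ) ^ k * (V₀ / ψ₀) ^ k) ^ 2 ≤ b → ∀ a : ℍ, a ∈ HubBulk ψ₀ → ∀ ε : GnoSign L, GoodSign ε →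
        |boxIntegral a ε b V₀ - (2 * Real.pi / b) ^ alpha L * ∫ p in BaseBox V₀, mbDensity a ε p| ≤
          K * (L : ℝ) ^ k * (V₀ / ψ₀) ^ k * b ^ (-(1 / 2 : ℝ)) * ((2 * Real.pi / b) ^ alpha L * ∫ p in BaseBox V₀, mbDensity a ε p) +
            (∫ η : GnoCoord L, gnoDensity η) * Real.exp (-(b * (ψ₀ / (K * (L : ℝ) ^ k * V₀ ^ k)) ^ k)))
    (hS3 : ∀ (L : ℕ) [NeZero L] (ε : GnoSign L), GoodSign ε →
      (∀ a p, 0 ≤ mbDensity (L := L) a ε p) ∧ Measurable (fun ap : ℍ × (ℝ × ℝ) => mbDensity (L := L) ap.1 ε ap.2) ∧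
        Integrable (fun ap : ℍ × (ℝ × ℝ) => mbDensity (L := L) ap.1 ε ap.2) (coneMeasure.prod volume)) :
    ∃ K : ℝ, 0 < K ∧ ∃ k : ℕ, ∀ (L : ℕ) [NeZero L] (ψ₀ V₀ b : ℝ), 0 < ψ₀ → ψ₀ ≤ 1 → 1 ≤ V₀ →
      (K * (L : ℝ) ^ k * (V₀ / ψ₀) ^ k) ^ 2 ≤ b →
        0 ≤ mbBulk L ψ₀ V₀ ∧
        |bulkIntegral L b ψ₀ V₀ - (2 * Real.pi / b) ^ alpha L * mbBulk L ψ₀ V₀| ≤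
          K * (L : ℝ) ^ k * (V₀ / ψ₀) ^ k * b ^ (-(1 / 2 : ℝ)) * ((2 * Real.pi / b) ^ alpha L * mbBulk L ψ₀ V₀) +
            Real.exp (-(b * (ψ₀ / (K * (L : ℝ) ^ k * V₀ ^ k)) ^ k)) := by
  obtain ⟨K, hK, k, h2⟩ := hS2
  refine ⟨K, hK, k, fun L _ ψ₀ V₀ b hψ0 hψ1 hV1 hb => ⟨mbBulk_nonneg ψ₀ V₀, ?_⟩⟩
  haveI := isProbabilityMeasure_coneMeasure
  have hb0 : 0 ≤ b := le_trans (sq_nonneg _) hb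
  -- letters
  set S : Set ℍ := HubBulk ψ₀ with hSdef
  set A : ℝ := (2 * Real.pi / b) ^ alpha L with hAdef
  set r : ℝ := K * (L : ℝ) ^ k * (V₀ / ψ₀) ^ k * b ^ (-(1 / 2 : ℝ)) with hrdef
  set E : ℝ := Real.exp (-(b * (ψ₀ / (K * (L : ℝ) ^ k * V₀ ^ k)) ^ k)) with hEdef
  set M : ℝ := ∫ η : GnoCoord L, gnoDensity η with hMdef
  set G : Finset (GnoSign L) := Finset.univ.filter (fun ε : GnoSign L => GoodSign ε) with hGdef
  have hS : MeasurableSet S := measurableSet_hubBulk ψ₀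
  have hSfin : coneMeasure S ≠ ⊤ := measure_ne_top _ _
  have hS1 : coneMeasure.real S ≤ 1 := by
    have h := prob_le_one (μ := coneMeasure) (s := S)
    rw [measureReal_def]
    exact ENNReal.toReal_le_of_le_ofReal zero_le_one (by rwa [ENNReal.ofReal_one])
  have hM0 : 0 ≤ M := integral_nonneg fun η => (gnoDensity_pos η).le
  have hE0 : 0 ≤ E := (Real.exp_pos _).le
  have hKL : 0 ≤ KL L := by have := coneConst_pos; unfold KL; positivity
  -- per good sign pattern: the integrated two-sided law on `S`
  have hper : ∀ ε ∈ G, |∫ a in S, boxIntegral a ε b V₀ ∂coneMeasure - A * ∫ a in S, (∫ p in BaseBox V₀, mbDensity a ε p) ∂coneMeasure| ≤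
      r * (A * ∫ a in S, (∫ p in BaseBox V₀, mbDensity a ε p) ∂coneMeasure) + M * E := by
    intro ε hε
    rw [hGdef, Finset.mem_filter] at hε
    obtain ⟨-, -, hint⟩ := hS3 L ε hε.2
    have h := setIntegral_two_sided_of_pointwise hS hSfin (integrable_boxIntegral hb0 ε V₀).integrableOn
      (integrable_baseBoxMass hint V₀).integrableOn (fun a ha => h2 L ψ₀ V₀ b hψ0 hψ1 hV1 hb a ha ε hε.2)
    refine h.trans (add_le_add le_rfl ?_)
    calc M * E * coneMeasure.real S ≤ M * E * 1 := mul_le_mul_of_nonneg_left hS1 (mul_nonneg hM0 hE0)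
      _ = M * E := mul_one _
  -- sum over the good patterns
  have esum : bulkIntegral L b ψ₀ V₀ - A * mbBulk L ψ₀ V₀ =
      KL L * ∑ ε ∈ G, (∫ a in S, boxIntegral a ε b V₀ ∂coneMeasure - A * ∫ a in S, (∫ p in BaseBox V₀, mbDensity a ε p) ∂coneMeasure) := by
    rw [Finset.sum_sub_distrib, ← Finset.mul_sum, mul_sub]
    simp only [bulkIntegral, mbBulk, ← hSdef, ← hGdef]
    ring
  have hsum : |bulkIntegral L b ψ₀ V₀ - A * mbBulk L ψ₀ V₀| ≤
      KL L * ∑ ε ∈ G, (r * (A * ∫ a in S, (∫ p in BaseBox V₀, mbDensity a ε p) ∂coneMeasure) + M * E) := by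
    rw [esum, abs_mul, abs_of_nonneg hKL]
    exact mul_le_mul_of_nonneg_left ((Finset.abs_sum_le_sum_abs _ _).trans (Finset.sum_le_sum hper)) hKL
  -- the absolute term: `K_L · #G · M ≤ K_L · #all · M = 1`
  have htot := gnomonic_total_mass_real (L := L) (χ := fun _ => (1 : SU2)) one_central
  have habs : KL L * ∑ _ε ∈ G, M * E ≤ E := by
    calc KL L * ∑ _ε ∈ G, M * E ≤ KL L * ∑ _ε : GnoSign L, M * E :=
          mul_le_mul_of_nonneg_left (Finset.sum_le_sum_of_subset_of_nonneg (Finset.filter_subset _ _) fun ε _ _ => mul_nonneg hM0 hE0) hKL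
      _ = (KL L * ∑ _ε : GnoSign L, M) * E := by rw [Finset.mul_sum, Finset.mul_sum, Finset.sum_mul]; exact Finset.sum_congr rfl fun ε _ => by ring
      _ = E := by rw [hMdef]; unfold KL; rw [htot, one_mul]
  have emain : KL L * ∑ ε ∈ G, r * (A * ∫ a in S, (∫ p in BaseBox V₀, mbDensity a ε p) ∂coneMeasure) = r * (A * mbBulk L ψ₀ V₀) := by
    simp only [mbBulk, ← hSdef, ← hGdef, Finset.mul_sum]
    exact Finset.sum_congr rfl fun ε _ => by ring
  calc |bulkIntegral L b ψ₀ V₀ - A * mbBulk L ψ₀ V₀|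
      ≤ KL L * ∑ ε ∈ G, (r * (A * ∫ a in S, (∫ p in BaseBox V₀, mbDensity a ε p) ∂coneMeasure) + M * E) := hsum
    _ = KL L * ∑ ε ∈ G, r * (A * ∫ a in S, (∫ p in BaseBox V₀, mbDensity a ε p) ∂coneMeasure) + KL L * ∑ _ε ∈ G, M * E := by
        rw [Finset.sum_add_distrib, mul_add]
    _ ≤ r * (A * mbBulk L ψ₀ V₀) + E := by rw [emain]; exact add_le_add le_rfl habs

/-- ★ **S2i GIVEN S3 ALONE** (S2 := w2 g59 ✓`bulk_fibred`, `K = 26963·82944⁸`, `k = 80`). [cite: Luscher1983, §2] -/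
theorem bulk_integrated_of_S3
    (hS3 : ∀ (L : ℕ) [NeZero L] (ε : GnoSign L), GoodSign ε →
      (∀ a p, 0 ≤ mbDensity (L := L) a ε p) ∧ Measurable (fun ap : ℍ × (ℝ × ℝ) => mbDensity (L := L) ap.1 ε ap.2) ∧
        Integrable (fun ap : ℍ × (ℝ × ℝ) => mbDensity (L := L) ap.1 ε ap.2) (coneMeasure.prod volume)) :
    ∃ K : ℝ, 0 < K ∧ ∃ k : ℕ, ∀ (L : ℕ) [NeZero L] (ψ₀ V₀ b : ℝ), 0 < ψ₀ → ψ₀ ≤ 1 → 1 ≤ V₀ →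
      (K * (L : ℝ) ^ k * (V₀ / ψ₀) ^ k) ^ 2 ≤ b →
        0 ≤ mbBulk L ψ₀ V₀ ∧
        |bulkIntegral L b ψ₀ V₀ - (2 * Real.pi / b) ^ alpha L * mbBulk L ψ₀ V₀| ≤
          K * (L : ℝ) ^ k * (V₀ / ψ₀) ^ k * b ^ (-(1 / 2 : ℝ)) * ((2 * Real.pi / b) ^ alpha L * mbBulk L ψ₀ V₀) +
            Real.exp (-(b * (ψ₀ / (K * (L : ℝ) ^ k * V₀ ^ k)) ^ k)) :=
  bulk_integrated_of_pointwise bulk_fibred hS3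

end Summit.QuantumFields.YangMills.Theorems.SwapVirialDeficit.SectorLaplace

end
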